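import Summits.BirchSwinnertonDyer.BirchSwinnertonDyer.Theorems.TeichmullerTwistDescentTwistLatticeUnstarred
import Summits.BirchSwinnertonDyer.BirchSwinnertonDyer.Theorems.TeichmullerTwistDescentCells57Residual
import Summits.BirchSwinnertonDyer.BirchSwinnertonDyer.Theorems.AdditiveKolyvaginRoadManinFrameResidueProperRTameTwistFull57FourLe
import Summits.BirchSwinnertonDyer.BirchSwinnertonDyer.Theorems.AdditiveKolyvaginRoadManinFrameResidueProperRTameTwistPotGood
import Summits.BirchSwinnertonDyer.Rank1Residual.Additive.UnramifiedBaseChange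
import HarnessLib

/-!
# Route `TeichmullerTwistDescent`, cruxes PSMU (stmt-BirchSwinnertonDyer-22638) / SCMU57
# (stmt-BirchSwinnertonDyer-22639): Manin's `p`-part is AT MOST ONE at every lattice-optimal datum of every
# curve additive at `p ≥ 5` with `E[p]` irreducible, GRANTED Kato's fact F″ (+ modularity,
# Dokchitser–Dokchitser) — Edixhoven's "at most once" below `p > 7`, by the `p*`-twist (`--supports`)

Cell `pub/bsd-wall` (D-0145 line route-BirchSwinnertonDyer-TeichmullerTwistDescent, OPEN rev 1), seat
`bsd-line-ttd-p2` (prover 2/2, g2). THEOREMS ONLY (no definition, no named fact, no `sorry`); nothing is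
closed unconditionally, no item is booked, BSD is not proved by this.

WHY. `TeichmullerTwistDescentManinUnitFromKatoTwistInputs.lean` (p588344) closed PSMU and SCMU57 BY NAME granted
{modularity, F″, L-TWIST, TORS-TWIST}; the two unit-twist inputs are needed on, and only on, the
Kosters–Pannekoek cells (`p ∈ {5, 7}`, Kodaira II/III at `5`, II at `7`, with a `ℚ_p`-rational point of order
`p`), where Kato's receptacle fails. THIS FILE measures that residual WITHOUT the two inputs: granted F″ (and
modularity, Dokchitser–Dokchitser — three cite-only facts) the defect is at most ONE factor `p`. The mechanism
is the quadratic twist by `χ_{p*}` at the additive prime itself (Stevens 1989 §5 on `Γ₀`, in the tree as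
`maninConstant_dvd_of_charTwist_gamma0`): the class `𝒜 ⊗ χ_{p*}` of an UNSTARRED additive class `𝒜`
(`ord_p Δ_min < 6`) is STARRED (`ord_p Δ_min + 6`), hence free of `ℚ_p`-rational `p`-torsion (Mazur's Step 1),
hence F″ gives it a Manin-unit datum; coming back to `𝒜` the Néron lattice of the minimal twist model is
`g(χ)⁻¹ Λ_W` (Stevens' Lemma (5.2), here proved for `ord_p Δ_min(W) < 6` — the printed version wants `W`
semistable at the twisting prime) while the `Γ₀`-twisting theorem gives `g(χ)·Λ(f_W) ⊆ Λ(f_A)`, and the two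
factors `g(χ)` multiply to `p*`: ONE factor `p` is lost, no more.

* The lattice tools (Stevens' Lemma (5.2) under `ord_q Δ_min < 6`; the `Γ₀` twist step with a `g(χ)²`
  shift) are the sibling `TeichmullerTwistDescentTwistLatticeUnstarred.lean`.
* §3 `dvd_pStar_mul_of_kato57_of_lt_six` — **at `p ∈ {5, 7}`, `ord_p Δ_min(W) < 6`, `E[p]` irreducible,
  `D` lattice-optimal at the conductor level: `c(D) ∣ p*·c'` with `p ∤ c'`**, GRANTED `hnf`, F″, `hDD`
  (`c'` = the constant of a conductor-level datum of the minimal model of `W ⊗ χ_{p*}`, a Manin unit by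
  `exists_member_not_dvd_c_of_tameTwist57_of_four_le` + `ManinFrameTransport`).
* §4 `not_sq_dvd_c_of_kato`, `padicValInt_c_le_one_of_kato` — **`ord_p c(D) ≤ 1` at EVERY lattice-optimal
  datum of EVERY curve additive at `p ≥ 5` with `E[p]` irreducible**, GRANTED `hnf`, F″, `hDD`; and `p ∤ c(D)`
  off `{p ∈ {5,7}, ord_p Δ_min < 6}` (at `p > 7` the full lever; at `ord_p Δ_min ≥ 6` no local `p`-torsion).
  `not_sq_dvd_c_of_kato_principalSeries_or_supercuspidal` — the same under the binders of PSMU / SCMU57.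

HONEST STATUS (numbers). Inputs: `exists_isNewformOf` (BCDT), F″ =
`kato_neron_isIntegral_twistedSymbolSum_of_additive_five_le` (derived reading of Kato (8.1.3)/9.7/6.6 +
Kim–Nakamura 2.1/2.4 + Kosters–Pannekoek Thm 1; XL, referee-flagged),
`dokchitser_padicValInt_minimalDiscriminantInt_eq_of_isogeny_of_not_dvd_degree` (Dokchitser–Dokchitser 2015
Thm. 5.1 (1)) — all cite-only. Output: `ord_p c ≤ 1` on the whole additive `p ≥ 5`, `E[p]`-irreducible locus
(Edixhoven 1991 Thm. 3 prints `ord_p c ≤ 1` for `p > 7` only), `= 0` off the Kosters–Pannekoek cells. The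
last factor `p` on those cells is what L-TWIST + TORS-TWIST (p588344) remove. `proof.conditional` by design;
BSD is not proved by this.
[cite: EdixhovenManin1991, Thm. 3 and §4 Prop. 9] [cite: Stevens1989, Lemma (5.2) p. 96, Lemma (5.4) p. 97]
[cite: Pal2012, Prop. 2.5 and Lemma 3.1] [cite: Kato2004Asterisque, (8.1.3) (p. 180), Thm. 9.7 (p. 189)]
[cite: KostersPannekoek2017, Thm. 1 and Cor. 2] [cite: Mazur1977, Ch. III §5, Step 1, p. 158]
[cite: DokchitserDokchitser2015LocalInvariants, Thm. 5.1 (1)] [cite: Shimura1971, Prop. 3.64]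
-/

set_option autoImplicit false
-- single-conjunct summit: `Summit.BirchSwinnertonDyer.BirchSwinnertonDyer.…` repeats the name by design
set_option linter.dupNamespace false

noncomputable section

open scoped Classical MatrixGroups ModularForm

open WeierstrassCurve IsDedekindDomain IsDedekindDomain.HeightOneSpectrum Rat.HeightOneSpectrum NumberField
  Literature.NumberTheory.EllipticCurves Literature.NumberTheory.EllipticCurves.ModularForms
  Literature.NumberTheory.EllipticCurves.Rank1Residual Literature.NumberTheory.DiophantineGeometry
  Summit.BirchSwinnertonDyer.Rank1Residual Summit.BirchSwinnertonDyer.Rank1Residual.Additive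
  Summit.BirchSwinnertonDyer.BirchSwinnertonDyer.Theses.TeichmullerTwistDescent
  Summit.BirchSwinnertonDyer.BirchSwinnertonDyer.Theorems CongruenceSubgroup

namespace Summit.BirchSwinnertonDyer.BirchSwinnertonDyer.Theorems.TeichmullerTwistDescent

/-! ### §3 The `p*`-twist at an unstarred additive `p ∈ {5, 7}`: `c(D) ∣ p*·c'` with `p ∤ c'`, GRANTED F″ -/

/-- At an additive `p ≥ 5` with `ord_p Δ_min < 6` there is no `Iₙ*` fibre at `(p)` (`Iₙ* ↦ n + 6`).
[cite: SilvermanATAEC1994, IV Table 4.1 (PDF p. 365)] -/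
theorem forall_ne_Istar_of_padicValInt_lt_six (W : WeierstrassCurve ℚ) [W.IsElliptic]
    [W.IsGloballyMinimal] (p : ℕ) [Fact p.Prime] (hp5 : 5 ≤ p) (hadd : Addv W p)
    (h6 : padicValInt p W.minimalDiscriminantInt < 6) :
    ∀ n : ℕ, W.kodairaSymbolAt (placeOf p) ≠ .Istar n := by
  intro n hk
  rcases kodairaSymbolAt_placeOf_cases_of_addv W p hp5 hadd with
    ⟨hk', -⟩ | ⟨hk', -⟩ | ⟨hk', -⟩ | ⟨m, hk', hv⟩ | ⟨hk', -⟩ | ⟨hk', -⟩ | ⟨hk', -⟩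
  all_goals first | omega | (rw [hk] at hk'; cases hk')

/-- **The `p*`-twist transfer at an unstarred additive prime `p ∈ {5, 7}`, GRANTED F″.** Let `W/ℚ` be
globally minimal, additive at `p ∈ {5, 7}` with `E[p]` irreducible and `ord_p Δ_min(W) < 6` (Kodaira II,
III or IV), `D` a LATTICE-OPTIMAL datum of `W` at its conductor level. GRANTED modularity (`hnf`), Kato's
fact F″ (`hK`) and Dokchitser–Dokchitser (`hDD`): `c(D) ∣ p* · c'` for some integer `c'` prime to `p` —
namely `c'` = the constant of a conductor-level datum of the globally minimal model `A` of `W ⊗ χ_{p*}`.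
Chain: `A` is additive at `p`, potentially good, with `ord_p Δ_min(A) = ord_p Δ_min(W) + 6 ≥ 6`
(`addv_of_twist_pStar`), so NO member of its class has a `ℚ_p`-rational point of order `p`
(`forall_member_noPTorsion_of_four_le`, via `hDD`) and the `p ∈ {5, 7}` tame-twist lever gives its optimal
member a Manin-unit datum (`exists_member_not_dvd_c_of_tameTwist57_of_four_le`), transported to `A`
prime-to-`p` (`ManinFrameTransport.exists_modularParametrizationData_not_dvd_of_partner`); the newform of
`W` is the `χ_{p*}`-twist of that of `A` (both curves additive at `p`: `a_n = 0` at the multiples of `p`;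
`LFunction_quadraticTwist_pStar_apply` elsewhere); `Λ_A = g(χ)⁻¹ Λ_W` by §1 (`ord_p Δ_min(W) < 6`);
`g(χ)² = p*`; then §2. The factor `p*` is exactly the defect of the Raynaud corner: from the STARRED side
(where F″ applies unconditionally) to the unstarred side one factor `p` is lost.
[cite: Stevens1989, Lemmas (5.2), (5.4)] [cite: Pal2012, Prop. 2.5] [cite: Kato2004Asterisque, Thm. 9.7 (p. 189)]
[cite: KostersPannekoek2017, Thm. 1 and Cor. 2] [cite: DokchitserDokchitser2015LocalInvariants, Thm. 5.1 (1)] -/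
theorem dvd_pStar_mul_of_kato57_of_lt_six (hnf : exists_isNewformOf)
    (hK : kato_neron_isIntegral_twistedSymbolSum_of_additive_five_le)
    (hDD : dokchitser_padicValInt_minimalDiscriminantInt_eq_of_isogeny_of_not_dvd_degree)
    (W : WeierstrassCurve ℚ) [W.IsElliptic] [W.IsGloballyMinimal] (p : ℕ) [hp : Fact p.Prime]
    [NeZero (W.conductorNorm ℤ)] (D : ModularParametrizationData W (W.conductorNorm ℤ))
    (hp57 : p = 5 ∨ p = 7) (hadd : Addv W p) (hirr : Irr W p)
    (h6 : padicValInt p W.minimalDiscriminantInt < 6)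
    (hlat : ∀ z ∈ D.L.lattice, ∃ w ∈ periodLattice D.f, z = D.c * w) :
    ∃ c' : ℤ, ¬ (p : ℤ) ∣ c' ∧ D.c ∣ ((-1 : ℤ) ^ (p / 2) * p) * c' := by
  have hpP : p.Prime := hp.out
  have hp5 : 5 ≤ p := by rcases hp57 with rfl | rfl <;> norm_num
  have hp2 : p ≠ 2 := by omega
  set d : ℤ := (-1 : ℤ) ^ (p / 2) * p with hd
  have hdZ : d ≠ 0 := mul_ne_zero (pow_ne_zero _ (by norm_num)) (by exact_mod_cast hpP.ne_zero)
  have hd0 : (d : ℚ) ≠ 0 := by exact_mod_cast hdZ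
  -- `W` is potentially good at `p`
  have hj : 0 ≤ padicValRat p W.j :=
    ManinFrameResidueProperRTameTwist.padicValRat_j_nonneg_of_addv_of_forall_kodairaSymbolAt_ne_Istar W hp2
      hadd (placeOf p) (natGenerator_placeOf p) (forall_ne_Istar_of_padicValInt_lt_six W p hp5 hadd h6)
  -- the globally minimal model `A` of `W ⊗ χ_{p*}`
  obtain ⟨A, hEA, hMA, CA, hCA⟩ := exists_minimal_twist_pStar p W
  haveI := hEA
  haveI := hMA
  haveI : NeZero (A.conductorNorm ℤ) := ⟨(A.conductorNorm_pos_holds).ne'⟩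
  have hCA' : CA • W.quadraticTwist (d : ℚ) = A := by rw [hd, (pStar_intCast p).1]; exact hCA
  obtain ⟨haddA, hjA, h6A⟩ := addv_of_twist_pStar p hp2 W A hj h6 CA hCA
  have hv' : CA⁻¹ • A = W.quadraticTwist (d : ℚ) := by rw [← hCA', inv_smul_smul]
  have hirrA : Irr A p :=
    BurungaleSkinnerTianWan2024.hasIrreducibleModPGaloisRep_of_smul_eq_quadraticTwist W A p hd0 hv' hirr
  -- the partner datum on `A` with `p ∤ c'` (F″ on the torsion-free class of `A`, transported to `A`)
  obtain ⟨W₀, hE₀, hM₀, D₀, hisoA, hc₀⟩ :=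
    ManinFrameResidueProperRTameTwist.exists_member_not_dvd_c_of_tameTwist57_of_four_le hK hDD hnf A hp57
      haddA hirrA hjA (by omega)
  haveI := hE₀
  haveI := hM₀
  obtain ⟨D', hc'⟩ :=
    ManinFrameTransport.exists_modularParametrizationData_not_dvd_of_partner A hpP hirrA hisoA D₀ hc₀
  -- levels: `N(A) = N(W)`, `p² ∣ N(W)`
  have hNA : A.conductorNorm ℤ = W.conductorNorm ℤ := conductorNorm_eq_of_twist_pStar p hp5 W A hadd haddA CA hCA
  have hN : A.conductorNorm ℤ ∣ W.conductorNorm ℤ := hNA ▸ dvd_rfl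
  have hpN : p ^ 2 ∣ W.conductorNorm ℤ := sq_dvd_conductorNorm_of_not_good_of_not_mult hadd
  -- the Legendre character mod `p` and its Gauss sum
  set χ := (quadraticChar (ZMod p)).ringHomComp (Int.castRingHom ℂ) with hχ
  have hχq := isQuadratic_quadraticChar_ringHomComp p
  have hχp := isPrimitive_quadraticChar_ringHomComp p hp2
  have hG := gaussSum_quadraticChar_ringHomComp_sq p hp2
  -- the coefficient relation `aₙ(f_D) = χ(n) aₙ(f_{D'})`
  have haddO : W.HasAdditiveReductionAt ((primesEquiv (R := 𝓞 ℚ)).symm ⟨p, hpP⟩) :=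
    Additive.hasAdditiveReductionAt_of_addv W p hadd
  have haddAO : A.HasAdditiveReductionAt ((primesEquiv (R := 𝓞 ℚ)).symm ⟨p, hpP⟩) :=
    Additive.hasAdditiveReductionAt_of_addv A p haddA
  have hvO : (primesEquiv ((primesEquiv (R := 𝓞 ℚ)).symm ⟨p, hpP⟩) : ℕ) = p :=
    Additive.primesEquiv_symm_apply_coe p
  have hcoef : ∀ n : ℕ, cuspCoeff D.f n = χ n * cuspCoeff D'.f n := by
    intro n
    rw [D.isNewformOf.2 n, D'.isNewformOf.2 n, hχ, quadraticChar_ringHomComp_apply_natCast p n]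
    by_cases hpn : p ∣ n
    · -- both sides vanish
      rw [W.LFunction_apply_eq_zero_of_hasAdditiveReductionAt hvO haddO hpn,
        A.LFunction_apply_eq_zero_of_hasAdditiveReductionAt hvO haddAO hpn]
      push_cast
      ring
    · haveI : (W.quadraticTwist (d : ℚ)).IsElliptic := W.isElliptic_quadraticTwist hd0
      rw [← hCA', LFunction_smul, W.LFunction_quadraticTwist_pStar_apply hp2 hpn]
      have hne : ((n : ℤ) : ZMod p) ≠ 0 := by
        rw [Int.cast_natCast, Ne, ZMod.natCast_eq_zero_iff]
        exact hpn
      push_cast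
      rcases legendreSym.eq_one_or_neg_one p hne with h1 | h1
      · rw [show (legendreSym p (n : ℤ)) = legendreSym p n from rfl, h1]; push_cast; ring
      · rw [show (legendreSym p (n : ℤ)) = legendreSym p n from rfl, h1]; push_cast; ring
  -- `Λ_A = g(χ)⁻¹ Λ_W` (§1: `ord_p Δ_min(W) < 6`)
  have hLA : ∀ z : ℂ, z ∈ D'.L.lattice ↔
      gaussSum χ (ZMod.stdAddChar (N := p)) * z ∈ D.L.lattice := fun z ↦
    neronLattice_quadraticTwist_pStar_of_lt_six W D.isNeronLattice hp2 h6 A ⟨CA, hCA'⟩ D'.isNeronLattice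
      hG z
  -- §2
  exact ⟨D'.c, hc', dvd_mul_of_charTwist_gamma0_of_sq D' D hlat hχq hχp hN hpN hcoef hG hLA⟩

/-! ### §4 Manin's `p`-part is at most one on the whole additive `p ≥ 5` locus with `E[p]` irreducible,
GRANTED F″ (+ modularity, Dokchitser–Dokchitser) -/

/-- **Edixhoven's "at most once" at EVERY additive `p ≥ 5`, GRANTED Kato's fact F″.** Let `W/ℚ` be globally
minimal, additive at a prime `p ≥ 5` with `E[p]` irreducible, and `D` a LATTICE-OPTIMAL parametrisation datum
of `W` at any level (`Λ_W = c·Λ_f`; the level is the conductor by `hnf`). GRANTED modularity (`hnf`), F″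
(`hK` = `kato_neron_isIntegral_twistedSymbolSum_of_additive_five_le`) and Dokchitser–Dokchitser (`hDD`):
`p² ∤ c(D)`. Indeed `p ∤ c(D)` unless `p ∈ {5, 7}` and `ord_p Δ_min(W) < 6`: at `p > 7` the full tame-twist
lever (`ManinFrameResidueProperRTameTwist.not_dvd_c_of_tameTwistL`, F′ := F″|_{p>7}); at `p ∈ {5, 7}` with
`ord_p Δ_min ≥ 6` the curve has no `ℚ_p`-rational `p`-torsion (Mazur's Step 1,
`eq_zero_of_prime_nsmul_eq_zero_of_addv_of_four_le`) and the `p ∈ {5, 7}` lever applies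
(`cell57_of_kato57_of_noPTorsion`); at `p ∈ {5, 7}` with `ord_p Δ_min < 6` (Kodaira II/III/IV, containing the
Kosters–Pannekoek cells) §3 gives `c ∣ p*·c'` with `p ∤ c'`. For `p > 7` the bound `ord_p(c) ≤ 1` on the
types II/III/IV is the second sentence of Edixhoven 1991 Thm. 3 (tree fact
`edixhoven_padicValInt_maninConstant_le_one`, cite-only); here it is extended to `p ∈ {5, 7}` granted F″, and
off the Kosters–Pannekoek cells sharpened to `p ∤ c`. CONDITIONAL (three cite-only facts); nothing is closed;
BSD is not proved by this. [cite: EdixhovenManin1991, Thm. 3 (second sentence) and §4 Prop. 9]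
[cite: Kato2004Asterisque, (8.1.3) (p. 180), Thm. 9.7 (p. 189)] [cite: KostersPannekoek2017, Thm. 1 and Cor. 2]
[cite: Stevens1989, Lemmas (5.2), (5.4)] [cite: DokchitserDokchitser2015LocalInvariants, Thm. 5.1 (1)] -/
theorem not_sq_dvd_c_of_kato (hnf : exists_isNewformOf)
    (hK : kato_neron_isIntegral_twistedSymbolSum_of_additive_five_le)
    (hDD : dokchitser_padicValInt_minimalDiscriminantInt_eq_of_isogeny_of_not_dvd_degree)
    (W : WeierstrassCurve ℚ) [W.IsElliptic] [W.IsGloballyMinimal] (p : ℕ) [hp : Fact p.Prime]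
    {N : ℕ} [NeZero N] (D : ModularParametrizationData W N)
    (hp5 : 5 ≤ p) (hadd : Addv W p) (hirr : Irr W p)
    (hlat : ∀ z ∈ D.L.lattice, ∃ w ∈ periodLattice D.f, z = D.c * w) :
    ¬ (p : ℤ) ^ 2 ∣ D.c := by
  have hpP : p.Prime := hp.out
  -- the level of the datum is the conductor (Carayol, from modularity)
  have hN : N = W.conductorNorm ℤ :=
    IsNewformOf.level_eq_conductorNorm_of_exists_isNewformOf hnf D.isNewformOf
  subst hN
  have hpN : p ^ 2 ∣ W.conductorNorm ℤ := sq_dvd_conductorNorm_of_not_good_of_not_mult hadd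
  have ha := lFunction_eq_one_or_neg_one_of_exactly_dvd_conductorNorm W
  have hsq_of_not : ¬ (p : ℤ) ∣ D.c → ¬ (p : ℤ) ^ 2 ∣ D.c := fun h h2 ↦ h ((dvd_pow_self _ two_ne_zero).trans h2)
  rcases Nat.lt_or_ge 7 p with h7 | h7
  · -- `p > 7`: `p ∤ c`
    exact hsq_of_not (ManinFrameResidueProperRTameTwist.not_dvd_c_of_tameTwistL
      (Cruxes.StarredOptimalManinUnitFiveSeven.KatoLever.kato_neron_of_five_le hK) W D hlat h7 hadd hirr hpN ha)
  · have hp57 : p = 5 ∨ p = 7 := by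
      interval_cases p <;>
        first | exact Or.inl rfl | exact Or.inr rfl | exact absurd hpP (by decide)
    by_cases h6 : padicValInt p W.minimalDiscriminantInt < 6
    · -- Kodaira II/III/IV at `p ∈ {5, 7}`: the `p*`-twist transfer, `c ∣ p*·c'`, `p ∤ c'`
      obtain ⟨c', hc', hdvd⟩ := dvd_pStar_mul_of_kato57_of_lt_six hnf hK hDD W p D hp57 hadd hirr h6 hlat
      intro h2
      apply hc'
      have h3 : (p : ℤ) * p ∣ ((-1 : ℤ) ^ (p / 2) * p) * c' := by rw [← sq]; exact h2.trans hdvd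
      rcases (pStar_intCast p).2 with hd | hd <;> rw [hd] at h3
      · exact (mul_dvd_mul_iff_left (by exact_mod_cast hpP.ne_zero : (p : ℤ) ≠ 0)).mp h3
      · rw [neg_mul, dvd_neg] at h3
        exact (mul_dvd_mul_iff_left (by exact_mod_cast hpP.ne_zero : (p : ℤ) ≠ 0)).mp h3
    · -- `ord_p Δ_min ≥ 6`: no `ℚ_p`-rational `p`-torsion, the `p ∈ {5, 7}` lever
      have hPT : ∀ P : (W.baseChange ℚ_[p]).toAffine.Point, p • P = 0 → P = 0 := fun P hP ↦
        eq_zero_of_prime_nsmul_eq_zero_of_addv_of_four_le W p hp5 hadd (by omega) hP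
      exact hsq_of_not (cell57_of_kato57_of_noPTorsion hK W p D hp57 hadd hirr hPT hlat)

/-- The same as a valuation bound: **`ord_p c(D) ≤ 1`**, granted `hnf`, F″, `hDD`.
[cite: EdixhovenManin1991, Thm. 3 (second sentence)] [cite: Kato2004Asterisque, Thm. 9.7 (p. 189)] -/
theorem padicValInt_c_le_one_of_kato (hnf : exists_isNewformOf)
    (hK : kato_neron_isIntegral_twistedSymbolSum_of_additive_five_le)
    (hDD : dokchitser_padicValInt_minimalDiscriminantInt_eq_of_isogeny_of_not_dvd_degree)
    (W : WeierstrassCurve ℚ) [W.IsElliptic] [W.IsGloballyMinimal] (p : ℕ) [hp : Fact p.Prime]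
    {N : ℕ} [NeZero N] (D : ModularParametrizationData W N)
    (hp5 : 5 ≤ p) (hadd : Addv W p) (hirr : Irr W p)
    (hlat : ∀ z ∈ D.L.lattice, ∃ w ∈ periodLattice D.f, z = D.c * w) :
    padicValInt p D.c ≤ 1 := by
  by_contra h
  have h2 : (p : ℤ) ^ 2 ∣ D.c :=
    (pow_dvd_pow (p : ℤ) (by omega : 2 ≤ padicValInt p D.c)).trans (padicValInt_dvd D.c)
  exact not_sq_dvd_c_of_kato hnf hK hDD W p D hp5 hadd hirr hlat h2

/-- **On the two cruxes of the route**: under the hypotheses of PSMU (stmt-BirchSwinnertonDyer-22638) resp.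
SCMU57 (stmt-BirchSwinnertonDyer-22639) — their Weil-type clauses unused — `p² ∤ c(D)`, GRANTED `hnf`, F″,
`hDD` only (no L-TWIST, no TORS-TWIST). So, granted the three cite-only facts, what separates the route's
Manin cruxes from closure is ONE factor `p` on the Kosters–Pannekoek cells `(p, ord_p Δ_min) ∈ {(5,2),(5,3),
(7,2)}` with `W(ℚ_p)[p] ≠ 0` — the Raynaud corner `e ≥ p − 1` of the route's own «why it might fail».
CONDITIONAL; nothing closed; BSD is not proved by this. [cite: EdixhovenManin1991, Thm. 3]
[cite: Kato2004Asterisque, Thm. 9.7 (p. 189)] [cite: KostersPannekoek2017, Cor. 2] -/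
theorem not_sq_dvd_c_of_kato_principalSeries_or_supercuspidal (hnf : exists_isNewformOf)
    (hK : kato_neron_isIntegral_twistedSymbolSum_of_additive_five_le)
    (hDD : dokchitser_padicValInt_minimalDiscriminantInt_eq_of_isogeny_of_not_dvd_degree) :
    (∀ (W : WeierstrassCurve ℚ) [W.IsElliptic] [W.IsGloballyMinimal] (p : ℕ) [Fact p.Prime] (N : ℕ)
      [NeZero N] (D : ModularParametrizationData W N), 5 ≤ p → Addv W p → Irr W p →
      (∃ (W' : WeierstrassCurve ℚ) (_ : W'.IsElliptic) (_ : W'.IsGloballyMinimal),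
        IsIsogenous W W' ∧ TypeGOrd W' p) →
      (∃ (W' : WeierstrassCurve ℚ) (_ : W'.IsElliptic) (_ : W'.IsGloballyMinimal),
        IsIsogenous W W' ∧ ∀ (v : HeightOneSpectrum ℤ) (n : ℕ), natGenerator v = p →
          W'.kodairaSymbolAt v ≠ KodairaSymbol.Istar n) →
      (∀ z ∈ D.L.lattice, ∃ w ∈ periodLattice D.f, z = D.c * w) → ¬ (p : ℤ) ^ 2 ∣ D.c) ∧
    (∀ (W : WeierstrassCurve ℚ) [W.IsElliptic] [W.IsGloballyMinimal] (p : ℕ) [Fact p.Prime] (N : ℕ)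
      [NeZero N] (D : ModularParametrizationData W N), (p = 5 ∨ p = 7) → Addv W p → Irr W p →
      (∀ (W' : WeierstrassCurve ℚ) [W'.IsElliptic] [W'.IsGloballyMinimal],
        IsIsogenous W W' → ¬ TypeGOrd W' p) →
      (∃ (W' : WeierstrassCurve ℚ) (_ : W'.IsElliptic) (_ : W'.IsGloballyMinimal),
        IsIsogenous W W' ∧ ∀ (v : HeightOneSpectrum ℤ) (n : ℕ), natGenerator v = p →
          W'.kodairaSymbolAt v ≠ KodairaSymbol.Istar n) →
      (∀ z ∈ D.L.lattice, ∃ w ∈ periodLattice D.f, z = D.c * w) → ¬ (p : ℤ) ^ 2 ∣ D.c) :=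
  ⟨fun W _ _ p _ N _ D hp5 hadd hirr _ _ hlat ↦ not_sq_dvd_c_of_kato hnf hK hDD W p D hp5 hadd hirr hlat,
    fun W _ _ p _ N _ D hp57 hadd hirr _ _ hlat ↦ not_sq_dvd_c_of_kato hnf hK hDD W p D
      (by rcases hp57 with rfl | rfl <;> omega) hadd hirr hlat⟩

end Summit.BirchSwinnertonDyer.BirchSwinnertonDyer.Theorems.TeichmullerTwistDescent

end
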